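import Mathlib
import Literature.Computability.Complexity.ACRealizeOver
import Literature.Computability.Complexity.ConstantDepth
import Literature.Computability.AlgebraicComplexity.BooleanGadgets
import HarnessLib

/-!
# Crux `MobiusLadder.LiouvilleOrthogonalTC0` (stmt-QuantumAdvantage-1393), line `Sketch`, v8.1 (Möbius bridge):
stub `stub_decideLt` — comparison of the input (read as a number, LSB first) with a constant, in `AC⁰` depth 3

The Boolean function `x ↦ [val x < X]`, `val x = ∑ᵢ xᵢ 2ⁱ` (`x : Fin n → Bool`, least significant
bit at index `0`), is realized over any basis `B ⊇ acBasis` in depth `≤ 3` with `≤ (n + 1)² + 1`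
gates.  If `2ⁿ ≤ X` the function is the constant `true` (one gate).  Otherwise it is the
lexicographic comparison with the bits `Xᵢ = X.testBit i`:
`val x < X ⟺ ∃ i < n, Xᵢ = 1 ∧ xᵢ = 0 ∧ ∀ j, i < j < n → xⱼ = Xⱼ`,
an `∨` (over the `i` with `Xᵢ = 1`) of `∧`s of `≤ n` input literals: depth `2`, size
`≤ n (n + 1) + 1`.
-/

set_option linter.dupNamespace false -- D-0017: single-problem summit ⇒ `QuantumAdvantage.QuantumAdvantage` by design

noncomputable section

namespace Summit.QuantumAdvantage.QuantumAdvantage.Theorems.LiouvilleOrthogonalTC0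

open Filter Finset
open Literature.Computability.Complexity

/-- **Comparison of naturals is lexicographic comparison of binary digits**: `a < b` iff at some
position `i` the bit of `a` is `0`, the bit of `b` is `1`, and all higher bits agree (the
position is the most significant bit of `a ^^^ b`). [folklore] -/
theorem decideLt_lt_iff_testBit (a b : ℕ) :
    a < b ↔ ∃ i, a.testBit i = false ∧ b.testBit i = true ∧
      ∀ j, i < j → a.testBit j = b.testBit j := by
  refine ⟨fun h => ?_, fun ⟨i, ha, hb, hj⟩ => Nat.lt_of_testBit i ha hb hj⟩
  obtain ⟨i, hi, hi'⟩ := Nat.exists_most_significant_bit (Nat.xor_ne_zero_iff.2 h.ne)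
  have hagree : ∀ j, i < j → a.testBit j = b.testBit j := fun j hj => by
    simpa [Nat.testBit_xor] using hi' j hj
  rw [Nat.testBit_xor] at hi
  rcases Bool.eq_false_or_eq_true (a.testBit i) with ha | ha
  · have hb : b.testBit i = false := by simpa [ha] using hi
    exact absurd (Nat.lt_of_testBit i hb ha fun j hj => (hagree j hj).symm) h.asymm
  · have hb : b.testBit i = true := by simpa [ha] using hi
    exact ⟨i, ha, hb, hagree⟩

/-- **Lexicographic comparison of an `n`-bit vector with a constant `X < 2ⁿ`**:
`ofBits x < X ⟺ ∃ i < n, xᵢ = 0 ∧ Xᵢ = 1 ∧ ∀ j, i < j < n → xⱼ = Xⱼ` (above `n` both numbers have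
no bits). [folklore] -/
theorem decideLt_ofBits_lt_iff {n X : ℕ} (hX : X < 2 ^ n) (x : Fin n → Bool) :
    Nat.ofBits x < X ↔ ∃ i : Fin n, x i = false ∧ X.testBit i = true ∧
      ∀ j : Fin n, (i : ℕ) < j → x j = X.testBit j := by
  have hXb : ∀ j, n ≤ j → X.testBit j = false := fun j hj =>
    Nat.testBit_lt_two_pow (hX.trans_le (Nat.pow_le_pow_right Nat.two_pos hj))
  rw [decideLt_lt_iff_testBit]
  constructor
  · rintro ⟨i, ha, hb, hj⟩
    have hi : i < n := by
      by_contra hin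
      rw [hXb i (not_lt.1 hin)] at hb
      exact Bool.false_ne_true hb
    refine ⟨⟨i, hi⟩, by rwa [Nat.testBit_ofBits_lt x i hi] at ha, hb, fun j hij => ?_⟩
    have := hj j hij
    rwa [Nat.testBit_ofBits_lt x j j.2] at this
  · rintro ⟨i, hxi, hXi, hj⟩
    refine ⟨i, by rw [Nat.testBit_ofBits_lt x i i.2]; exact hxi, hXi, fun j hij => ?_⟩
    by_cases hjn : j < n
    · rw [Nat.testBit_ofBits_lt x j hjn]
      exact hj ⟨j, hjn⟩ hij
    · rw [Nat.testBit_ofBits_ge x j (not_lt.1 hjn), hXb j (not_lt.1 hjn)]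

/-- Semantics of the `i`-th conjunction of the comparison circuit: its literals
(`xⱼ ↔ Xⱼ` for `j > i`, `¬ xᵢ` otherwise) all hold iff `xᵢ = 0` and `x` agrees with the bits of
`X` above `i`. [folklore] -/
theorem decideLt_block_iff {n : ℕ} (X : ℕ) (i : Fin n) (x : Fin n → Bool) :
    (∀ j : Fin n, (if (i : ℕ) < j then (x j == X.testBit j) else !x i) = true) ↔
      (x i = false ∧ ∀ j : Fin n, (i : ℕ) < j → x j = X.testBit j) := by
  constructor
  · intro H
    refine ⟨by simpa using H i, fun j hj => ?_⟩
    simpa [hj] using H j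
  · rintro ⟨hi, hj⟩ j
    by_cases h : (i : ℕ) < j
    · simpa [h] using hj j h
    · simp [h, hi]

/-- The literals of the comparison circuit (`xⱼ ↔ Xⱼ`, i.e. `xⱼ` or `¬ xⱼ` according to the
constant bit `Xⱼ`, for `j > i`; `¬ xᵢ` otherwise) are input literals: depth `0`, at most one
(negation) gate. [cite: Vollmer1999, §1.2] -/
theorem decideLt_lit {B : Set GateFn} (hB : acBasis ⊆ B) {n : ℕ} (X : ℕ) (i j : Fin n) :
    ACRealOver B (fun x : Fin n → Bool => if (i : ℕ) < j then (x j == X.testBit j) else !x i)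
      0 1 := by
  have hnot : GateFn.not ∈ B := hB mem_acBasis_not
  by_cases hij : (i : ℕ) < j
  · simp only [hij, if_true]
    rcases Bool.eq_false_or_eq_true (X.testBit j) with h | h
    · simp only [h, beq_true]
      exact (acRealOver_input B j).mono le_rfl (Nat.zero_le 1)
    · simp only [h, beq_false]
      exact acRealOver_notInput hnot j
  · simp only [hij, if_false]
    exact acRealOver_notInput hnot i

/-- The `i`-th conjunction of the comparison circuit (an `∧` of `n` input literals): depth `1`,
at most `n + 1` gates. [cite: Vollmer1999, §1.2] -/
theorem decideLt_block {B : Set GateFn} (hB : acBasis ⊆ B) {n : ℕ} (X : ℕ) (i : Fin n) :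
    ACRealOver B (fun x : Fin n → Bool => decide (∀ j : Fin n,
      (if (i : ℕ) < j then (x j == X.testBit j) else !x i) = true)) 1 (n * 1 + 1) :=
  acRealOver_forall_const hB
    (f := fun (j : Fin n) (x : Fin n → Bool) => if (i : ℕ) < j then (x j == X.testBit j) else !x i)
    fun j => decideLt_lit hB X i j

/-- The `i`-th disjunct of the comparison circuit: the `i`-th conjunction if `Xᵢ = 1`, the
constant `false` (one gate) if `Xᵢ = 0`; depth `1`, at most `n + 1` gates. [cite: Vollmer1999, §1.2] -/
theorem decideLt_disjunct {B : Set GateFn} (hB : acBasis ⊆ B) {n : ℕ} (X : ℕ) (i : Fin n) :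
    ACRealOver B (fun x : Fin n → Bool => X.testBit i && decide (∀ j : Fin n,
      (if (i : ℕ) < j then (x j == X.testBit j) else !x i) = true)) 1 (n + 1) := by
  rcases Bool.eq_false_or_eq_true (X.testBit i) with h | h
  · exact ((decideLt_block hB X i).mono le_rfl (by rw [mul_one])).congr fun x => by
      rw [h, Bool.true_and]
  · exact ((acRealOver_const hB false).mono le_rfl (Nat.le_add_left 1 n)).congr fun x => by
      rw [h, Bool.false_and]

/-- **Comparison with a constant in `AC⁰` depth `3`.** The Boolean function `x ↦ [val x < X]`,
`val x = ∑ᵢ xᵢ 2ⁱ` (`x : Fin n → Bool`, least significant bit first), is realized over any basis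
`B ⊇ acBasis` in depth `≤ 3` with `≤ (n + 1)² + 1` gates: for `2ⁿ ≤ X` it is the constant `true`;
for `X < 2ⁿ` it is the lexicographic comparison `∨ᵢ (Xᵢ ∧ ¬xᵢ ∧ ∧_{j>i} (xⱼ ↔ Xⱼ))`, an `∨` of
`n` blocks of depth `1` and size `≤ n + 1`. [cite: Vollmer1999, §1.2] -/
theorem stub_decideLt {B : Set GateFn} (hB : acBasis ⊆ B) (n X : ℕ) : ACRealOver B (fun x : Fin n → Bool => decide (∑ i : Fin n, (x i).toNat * 2 ^ (i : ℕ) < X)) 3 ((n + 1) ^ 2 + 1) := by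
  have hval : ∀ x : Fin n → Bool, ∑ i : Fin n, (x i).toNat * 2 ^ (i : ℕ) = Nat.ofBits x :=
    fun x => (Literature.Computability.AlgebraicComplexity.BoolGadgets.ofBits_eq_sum x).symm
  by_cases hX : 2 ^ n ≤ X
  · -- `val x < 2ⁿ ≤ X`: the constant `true`
    refine ((acRealOver_const hB true).mono (by norm_num) (Nat.le_add_left 1 _)).congr fun x => ?_
    rw [hval x]
    exact (decide_eq_true ((Nat.ofBits_lt_two_pow x).trans_le hX)).symm
  · -- `X < 2ⁿ`: the lexicographic comparison circuit
    rw [not_le] at hX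
    have hOr := acRealOver_exists_const hB fun i : Fin n => decideLt_disjunct hB X i
    have hsize : n * (n + 1) + 1 ≤ (n + 1) ^ 2 + 1 := by
      rw [sq]
      exact Nat.add_le_add_right (Nat.mul_le_mul_right (n + 1) (Nat.le_succ n)) 1
    refine (hOr.mono (by norm_num) hsize).congr fun x => ?_
    rw [hval x]
    simp only [decide_eq_decide, Bool.and_eq_true, decide_eq_true_eq]
    rw [decideLt_ofBits_lt_iff hX x]
    simp only [decideLt_block_iff]
    exact ⟨fun ⟨i, hXi, hxi, hj⟩ => ⟨i, hxi, hXi, hj⟩, fun ⟨i, hxi, hXi, hj⟩ => ⟨i, hXi, hxi, hj⟩⟩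

end Summit.QuantumAdvantage.QuantumAdvantage.Theorems.LiouvilleOrthogonalTC0
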